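import Mathlib.Analysis.InnerProductSpace.Adjoint
import Mathlib.Analysis.InnerProductSpace.l2Space
import HarnessLib

/-!
# The diagonal of a nuclear operator `Σ_k λ_k |p_k⟩⟨q_k|` along an orthonormal family is absolutely summable,
# with `Σ_i |Σ_k λ_k ⟨e_i, p_k⟩⟨q_k, e_i⟩| ≤ Σ_k |λ_k| (‖p_k‖² + ‖q_k‖²)`, and the sandwiched form `⟨e_i, X T Y e_i⟩`

LABEL (line 1): RH-FREE generic Hilbert-space toolkit (theorems only; NO definition, NO named fact).  Used by
the "annulus road" under `Connes1999_thm_VII_4_rat` (cell `rh-crit`, sub-cell cc, row O1): step (iv) of the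
separated-remainder estimate — the uniform trace-norm bound (S1) of `ϑ(g) T_M ϑ_m` for the rank-one expansion
`T_M = Σ_k λ_k |u_k⟩⟨w_k|` of the separated sinc operator.  WHAT THIS IS NOT: anything about RH.

Source.  M. Reed, B. Simon, *Methods of Modern Mathematical Physics I* (1972) [`ReedSimon1972`], Thm. VI.18,
VI.24 (trace of a trace-class operator along any orthonormal basis), PDF pp. 196–199; Bessel's inequality.

## What is proved

* `summable_norm_mul_inner_sq_add_of_orthonormal` — `(i,k) ↦ |λ_k|(|⟨e_i,p_k⟩|² + |⟨q_k,e_i⟩|²)` is summable when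
  `Σ_k |λ_k|(‖p_k‖² + ‖q_k‖²) < ∞` (Bessel);
* **`tsum_norm_rankOne_diag_le`** — `Σ_i Σ_k |λ_k ⟨e_i,p_k⟩⟨q_k,e_i⟩| ≤ Σ_k |λ_k| (‖p_k‖² + ‖q_k‖²)`, hence the
  diagonal `d_i = Σ_k λ_k ⟨e_i,p_k⟩⟨q_k,e_i⟩` satisfies `Σ_i |d_i| ≤ Σ_k |λ_k|(‖p_k‖² + ‖q_k‖²)`;
* **`hasSum_inner_sandwich`** — if `T φ = Σ_k λ_k ⟨w_k, φ⟩ u_k` for all `φ`, then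
  `⟨e_i, X T Y e_i⟩ = Σ_k λ_k ⟨e_i, X u_k⟩ ⟨Y† w_k, e_i⟩` (the form to which the above applies with
  `p_k = X u_k`, `q_k = Y† w_k`).

No instance, notation or attribute; no `def`.
-/

noncomputable section

open Filter
open scoped Topology ComplexConjugate InnerProductSpace

namespace Literature.Analysis.OperatorTheory

variable {E : Type*} [NormedAddCommGroup E] [InnerProductSpace ℂ E]
variable {ι κ : Type*}

/-- **Bessel bound for the double family** `(i,k) ↦ |λ_k|(|⟨e_i, p_k⟩|² + |⟨q_k, e_i⟩|²)`. [cite: ReedSimon1972, Thm. VI.18 and VI.24, PDF pp. 196–199] -/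
theorem summable_norm_mul_inner_sq_add_of_orthonormal {e : ι → E} (he : Orthonormal ℂ e) (p q : κ → E)
    (lam : κ → ℂ) (hsum : Summable fun k => ‖lam k‖ * (‖p k‖ ^ 2 + ‖q k‖ ^ 2)) :
    (Summable fun ik : ι × κ => ‖lam ik.2‖ * (‖⟪e ik.1, p ik.2⟫_ℂ‖ ^ 2 + ‖⟪q ik.2, e ik.1⟫_ℂ‖ ^ 2)) ∧
    ∑' ik : ι × κ, ‖lam ik.2‖ * (‖⟪e ik.1, p ik.2⟫_ℂ‖ ^ 2 + ‖⟪q ik.2, e ik.1⟫_ℂ‖ ^ 2) ≤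
      ∑' k, ‖lam k‖ * (‖p k‖ ^ 2 + ‖q k‖ ^ 2) := by
  classical
  have hconj : ∀ k i, ‖⟪q k, e i⟫_ℂ‖ = ‖⟪e i, q k⟫_ℂ‖ := fun k i => by
    rw [← inner_conj_symm, Complex.norm_conj]
  have hk : ∀ k, Summable fun i => ‖lam k‖ * (‖⟪e i, p k⟫_ℂ‖ ^ 2 + ‖⟪q k, e i⟫_ℂ‖ ^ 2) := by
    intro k
    refine ((he.inner_products_summable (x := p k)).add ?_).mul_left _
    simp_rw [hconj k]
    exact he.inner_products_summable (x := q k)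
  have hle : ∀ k, ∑' i, ‖lam k‖ * (‖⟪e i, p k⟫_ℂ‖ ^ 2 + ‖⟪q k, e i⟫_ℂ‖ ^ 2) ≤
      ‖lam k‖ * (‖p k‖ ^ 2 + ‖q k‖ ^ 2) := by
    intro k
    have h1 : ∑' i, ‖⟪e i, p k⟫_ℂ‖ ^ 2 ≤ ‖p k‖ ^ 2 := he.tsum_inner_products_le (x := p k)
    have hs2 : Summable fun i => ‖⟪q k, e i⟫_ℂ‖ ^ 2 := by
      simp_rw [hconj k]; exact he.inner_products_summable (x := q k)
    have h2 : ∑' i, ‖⟪q k, e i⟫_ℂ‖ ^ 2 ≤ ‖q k‖ ^ 2 := by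
      simp_rw [hconj k]; exact he.tsum_inner_products_le (x := q k)
    rw [tsum_mul_left, (he.inner_products_summable (x := p k)).tsum_add hs2]
    exact mul_le_mul_of_nonneg_left (add_le_add h1 h2) (norm_nonneg _)
  have hnn : ∀ ki : κ × ι, 0 ≤ ‖lam ki.1‖ * (‖⟪e ki.2, p ki.1⟫_ℂ‖ ^ 2 + ‖⟪q ki.1, e ki.2⟫_ℂ‖ ^ 2) :=
    fun ki => by positivity
  have hprod : Summable fun ki : κ × ι =>
      ‖lam ki.1‖ * (‖⟪e ki.2, p ki.1⟫_ℂ‖ ^ 2 + ‖⟪q ki.1, e ki.2⟫_ℂ‖ ^ 2) := by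
    refine (summable_prod_of_nonneg hnn).2 ⟨hk, ?_⟩
    exact Summable.of_nonneg_of_le (fun k => tsum_nonneg fun i => by positivity) hle hsum
  have hswap : Summable fun ik : ι × κ => ‖lam ik.2‖ * (‖⟪e ik.1, p ik.2⟫_ℂ‖ ^ 2 + ‖⟪q ik.2, e ik.1⟫_ℂ‖ ^ 2) :=
    (Equiv.prodComm ι κ).summable_iff.2 hprod |>.congr fun _ => rfl
  refine ⟨hswap, ?_⟩
  -- `Σ_{(i,k)} = Σ_k Σ_i ≤ Σ_k |λ_k|(‖p_k‖²+‖q_k‖²)`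
  have heq : ∑' ik : ι × κ, ‖lam ik.2‖ * (‖⟪e ik.1, p ik.2⟫_ℂ‖ ^ 2 + ‖⟪q ik.2, e ik.1⟫_ℂ‖ ^ 2) =
      ∑' ki : κ × ι, ‖lam ki.1‖ * (‖⟪e ki.2, p ki.1⟫_ℂ‖ ^ 2 + ‖⟪q ki.1, e ki.2⟫_ℂ‖ ^ 2) :=
    ((Equiv.prodComm κ ι).tsum_eq (fun ik : ι × κ =>
      ‖lam ik.2‖ * (‖⟪e ik.1, p ik.2⟫_ℂ‖ ^ 2 + ‖⟪q ik.2, e ik.1⟫_ℂ‖ ^ 2))).symm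
  rw [heq, hprod.tsum_prod]
  exact Summable.tsum_le_tsum hle hprod.prod hsum

/-- **`Σ_i Σ_k |λ_k ⟨e_i,p_k⟩⟨q_k,e_i⟩| ≤ Σ_k |λ_k| (‖p_k‖² + ‖q_k‖²)`** along any orthonormal family: the double
family of diagonal coefficients of the nuclear operator `Σ_k λ_k |p_k⟩⟨q_k|` is absolutely summable with this
bound; in particular `Σ_i |Σ_k λ_k ⟨e_i,p_k⟩⟨q_k,e_i⟩| ≤ Σ_k |λ_k|(‖p_k‖² + ‖q_k‖²)`. [cite: ReedSimon1972, Thm. VI.18 and VI.24, PDF pp. 196–199] -/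
theorem tsum_norm_rankOne_diag_le {e : ι → E} (he : Orthonormal ℂ e) (p q : κ → E) (lam : κ → ℂ)
    (hsum : Summable fun k => ‖lam k‖ * (‖p k‖ ^ 2 + ‖q k‖ ^ 2)) :
    (Summable fun ik : ι × κ => lam ik.2 * (⟪e ik.1, p ik.2⟫_ℂ * ⟪q ik.2, e ik.1⟫_ℂ)) ∧
    (Summable fun i => ‖∑' k, lam k * (⟪e i, p k⟫_ℂ * ⟪q k, e i⟫_ℂ)‖) ∧
    ∑' i, ‖∑' k, lam k * (⟪e i, p k⟫_ℂ * ⟪q k, e i⟫_ℂ)‖ ≤ ∑' k, ‖lam k‖ * (‖p k‖ ^ 2 + ‖q k‖ ^ 2) := by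
  obtain ⟨hS, hB⟩ := summable_norm_mul_inner_sq_add_of_orthonormal he p q lam hsum
  -- termwise: `|λ ab| ≤ |λ|(|a|² + |b|²)`
  have hterm : ∀ ik : ι × κ, ‖lam ik.2 * (⟪e ik.1, p ik.2⟫_ℂ * ⟪q ik.2, e ik.1⟫_ℂ)‖ ≤
      ‖lam ik.2‖ * (‖⟪e ik.1, p ik.2⟫_ℂ‖ ^ 2 + ‖⟪q ik.2, e ik.1⟫_ℂ‖ ^ 2) := fun ik => by
    rw [norm_mul, norm_mul]
    refine mul_le_mul_of_nonneg_left ?_ (norm_nonneg _)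
    nlinarith [sq_nonneg (‖⟪e ik.1, p ik.2⟫_ℂ‖ - ‖⟪q ik.2, e ik.1⟫_ℂ‖), norm_nonneg ⟪e ik.1, p ik.2⟫_ℂ,
      norm_nonneg ⟪q ik.2, e ik.1⟫_ℂ]
  have hA : Summable fun ik : ι × κ => lam ik.2 * (⟪e ik.1, p ik.2⟫_ℂ * ⟪q ik.2, e ik.1⟫_ℂ) :=
    Summable.of_norm_bounded hS hterm
  have hN : Summable fun ik : ι × κ => ‖lam ik.2 * (⟪e ik.1, p ik.2⟫_ℂ * ⟪q ik.2, e ik.1⟫_ℂ)‖ :=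
    Summable.of_nonneg_of_le (fun _ => norm_nonneg _) hterm hS
  -- `Σ_i ‖Σ_k‖ ≤ Σ_i Σ_k ‖·‖ = Σ_{(i,k)} ‖·‖ ≤ Σ_{(i,k)} |λ|(…) ≤ Σ_k |λ_k|(‖p_k‖²+‖q_k‖²)`
  have h1 : ∀ i, ‖∑' k, lam k * (⟪e i, p k⟫_ℂ * ⟪q k, e i⟫_ℂ)‖ ≤
      ∑' k, ‖lam k * (⟪e i, p k⟫_ℂ * ⟪q k, e i⟫_ℂ)‖ := fun i =>
    norm_tsum_le_tsum_norm (hN.prod_factor i)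
  have h2 : Summable fun i => ∑' k, ‖lam k * (⟪e i, p k⟫_ℂ * ⟪q k, e i⟫_ℂ)‖ := hN.prod
  have hsumm : Summable fun i => ‖∑' k, lam k * (⟪e i, p k⟫_ℂ * ⟪q k, e i⟫_ℂ)‖ :=
    Summable.of_nonneg_of_le (fun _ => norm_nonneg _) h1 h2
  refine ⟨hA, hsumm, ?_⟩
  calc ∑' i, ‖∑' k, lam k * (⟪e i, p k⟫_ℂ * ⟪q k, e i⟫_ℂ)‖
      ≤ ∑' i, ∑' k, ‖lam k * (⟪e i, p k⟫_ℂ * ⟪q k, e i⟫_ℂ)‖ := Summable.tsum_le_tsum h1 hsumm h2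
    _ = ∑' ik : ι × κ, ‖lam ik.2 * (⟪e ik.1, p ik.2⟫_ℂ * ⟪q ik.2, e ik.1⟫_ℂ)‖ := (hN.tsum_prod).symm
    _ ≤ ∑' ik : ι × κ, ‖lam ik.2‖ * (‖⟪e ik.1, p ik.2⟫_ℂ‖ ^ 2 + ‖⟪q ik.2, e ik.1⟫_ℂ‖ ^ 2) :=
        Summable.tsum_le_tsum hterm hN hS
    _ ≤ ∑' k, ‖lam k‖ * (‖p k‖ ^ 2 + ‖q k‖ ^ 2) := hB

section Sandwich

variable [CompleteSpace E]

/-- **The sandwiched diagonal coefficient**: if `T φ = Σ_k λ_k ⟨w_k, φ⟩ u_k` (norm-convergent) for every `φ`,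
then for bounded `X, Y` and any vector `x`,
`⟨x, X T Y x⟩ = Σ_k λ_k ⟨x, X u_k⟩ ⟨Y† w_k, x⟩` — the form `Σ_k λ_k ⟨x, p_k⟩⟨q_k, x⟩` with `p_k = X u_k`,
`q_k = Y† w_k`, `‖p_k‖ ≤ ‖X‖‖u_k‖`, `‖q_k‖ ≤ ‖Y‖‖w_k‖`. [cite: ReedSimon1972, Thm. VI.18 and VI.24, PDF pp. 196–199] -/
theorem hasSum_inner_sandwich {T X Y : E →L[ℂ] E} {u w : κ → E} {lam : κ → ℂ}
    (hT : ∀ φ : E, HasSum (fun k => (lam k * ⟪w k, φ⟫_ℂ) • u k) (T φ)) (x : E) :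
    HasSum (fun k => lam k * (⟪x, X (u k)⟫_ℂ * ⟪ContinuousLinearMap.adjoint Y (w k), x⟫_ℂ))
      ⟪x, X (T (Y x))⟫_ℂ := by
  have h := ((hT (Y x)).mapL X)
  -- `X (T (Y x)) = Σ_k (λ_k ⟨w_k, Yx⟩) • X u_k`; pair with `x`
  have h2 := h.mapL (innerSL ℂ x)
  simp only [innerSL_apply_apply] at h2
  have hfun : (fun k => lam k * (⟪x, X (u k)⟫_ℂ * ⟪ContinuousLinearMap.adjoint Y (w k), x⟫_ℂ)) =
      fun b => ⟪x, X ((lam b * ⟪w b, Y x⟫_ℂ) • u b)⟫_ℂ := by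
    funext k
    rw [map_smul, inner_smul_right, ContinuousLinearMap.adjoint_inner_left]
    ring
  rw [hfun]
  exact h2

end Sandwich

end Literature.Analysis.OperatorTheory
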